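import Summits.BirchSwinnertonDyer.Rank1Residual.X12.O11.RamifiedEllipticUnitMechanismZpThreeV
import HarnessLib

/-!
# O11 at `p = 3`: the displayed control defect `d(T₀)` DOES NOT DEPEND on the admissible set `T₀`
# (cell `bsd-print-cfram`, D-0131 (2), typer `ty2` gen 3; a CONSISTENCY check on the carriers
# (R-ctrl)₃ᵛ♯ / (R-EU)₃ᵛ / (PR|IMC)₃ᴺ∪ⱽ (p553473, p557337) and their regime-T twins, which quantify over
# EVERY admissible `T₀` with a `T₀`-free left-hand side; NOTHING about BSD asserted)

HONEST FRAMING (cell `bsd-print-cfram`, HOME `run/shared/lean/pub/bsd-print-cfram/`): THEOREMS ONLY (no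
definition, no named fact, no axiom, no `sorry`); regimes N, V, T and the leaf stay OPEN; beyond-print
theorem: NO (bookkeeping on the tree's objects).

WHY. The typed laws at `3` («`n₀ + log₃ #X[T] = n + n' + ord₃ q + ord₃ q' + log₃ d(T₀)`», «`c (+ log₃ d₀)
= … + log₃ d(T₀)`») bind a finite set `T₀` of places `v ∤ 3` of `K = ℚ(√−3)` that is ADMISSIBLE — at
every degree-one `v ∤ 3` OUTSIDE `T₀`, `W_K` has good reduction at `v` or `W(K_v)[3] = 0` — and state the
identity for EVERY such `T₀`, with `d(T₀) = controlDefectAtThree W K 𝔭 κ T₀` displayed and everything else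
`T₀`-free. Were `d(T₀)` to depend on the admissible `T₀`, those `@[conjecture]` inputs would be FALSE
rather than open. This file proves it does not:

* §1 (generic: any `E/K`, `K` totally complex, any `p`, `κ`, `𝔭`, `Σ`):
  `natCard_range_locAtFinset_eq_of_subset` — for finite sets `𝔭 ∈ T ⊆ T'` of places (members `≠ 𝔭` not
  above `p`, all `∉ Σ`) such that the away conditions descend off the SMALLER set `T`, the images of
  Greenberg's `A = res⁻¹(Sel_𝔭^Σ(K_∞, E[p^∞]))` under `loc_T` and `loc_{T'}` have the same order: both
  localisation maps restricted to `A` have kernel EXACTLY `Sel_𝔭^Σ(K, E[p^∞])`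
  (`mem_selmerAcBase_iff_locAtFinset_eq_zero_strict`), so both images are `≅ A / Sel_𝔭^Σ(K)`.
* §2 at a `3`-frame, anticyclotomic `κ` — NO (A𝔭)₃, no finiteness hypothesis:
  `controlDefectAtThree_eq_of_subset` (`T₀ ⊆ T₀'`, `T₀` admissible, `T₀'` prime to `3` ⟹
  `d(T₀') = d(T₀)`), `controlDefectAtThree_eq_of_admissible` (any two admissible sets give the same
  `d`, via their union), and `controlDefectAtThree_eq_empty_of_admissible` (if `∅` is admissible —
  regime N ∪ T-without-V-places — every admissible `T₀` has `d(T₀) = d(∅)`, which is `1` under (A𝔭)₃ by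
  `controlDefectAtThree_empty_eq_one`). The away descent off `{𝔭} ∪ T₀` is companion V's pointwise
  trichotomy argument (split: admissibility; inert / ramified: anticyclotomic splitting), verbatim.
So `d(T₀)` is an invariant of `(W, K, 𝔭, κ)` and the regime: `d = d(S)` for the set `S` of degree-one
places `v ∤ 3` with bad reduction and `W(K_v)[3] ≠ 0` (lit DOSSIER §32/§35: `d(S_V) = 3^{#S_V − t}`).

References: [GreenbergLNM1716] §3 Lemmas 3.1–3.3 and §4 Prop. 4.13 (the global-to-local term);
[JetchevSkinnerWan2017] §3.3 Prop. 3.3.7 (shape); tree: companion V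
`X12/O11/RamifiedStrictDescentAtThreeDefect.lean`, `X12/O11/RamifiedStrictDescentAtThreeRegimeV.lean`
(`controlDefectAtThree`), X11b `BDPRouteControlStrictPlace.lean`; HOME/TY2-DISCHARGE-TABLE.md §E–§F.
-/

noncomputable section

open scoped Classical

open WeierstrassCurve NumberField IsDedekindDomain Field
  Literature.NumberTheory.EllipticCurves
  Literature.NumberTheory.EllipticCurves.GreenbergSelmer
  Literature.NumberTheory.EllipticCurves.Rank1Residual
  Literature.NumberTheory.GaloisRepresentations
  Summit.BirchSwinnertonDyer.Rank1Residual
  Summit.BirchSwinnertonDyer.Rank1Residual.Additive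
  Summit.BirchSwinnertonDyer.Rank1Residual.X11b
  Summit.BirchSwinnertonDyer.Rank1Residual.X11b.AcSelmer
  Summit.BirchSwinnertonDyer.BirchSwinnertonDyer.Theorems

namespace Summit.BirchSwinnertonDyer.Rank1Residual.X12.O11

/-! ## §1 Generic: the localisation image of `A` has the same order on nested finite sets -/

section Generic

variable {K : Type} [Field K] [NumberField K]
variable {E : WeierstrassCurve K} {p : ℕ} [Fact p.Prime] {κ : ZpExtension K p}
  {𝔭 : HeightOneSpectrum (𝓞 K)} {S : Set (HeightOneSpectrum (𝓞 K))}

/-- **The displayed global-to-local term is independent of the finite set (Greenberg §3).** For `E`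
over a totally complex `K`, `κ`, `𝔭`, `Σ`, and finite sets `𝔭 ∈ T ⊆ T'` of finite places (members
`≠ 𝔭` not above `p`, all `∉ Σ`) such that the away conditions descend off `T` (`hS`: a class of `A`
is locally trivial at every `v ∤ p`, `v ∉ Σ ∪ T`): the images of `A = res⁻¹(Sel_𝔭^Σ(K_∞, E[p^∞]))`
under `loc_T` and `loc_{T'}` (`AcSelmer.locAtFinset`) have the same order (as `Nat.card`; no finiteness
needed). Both restricted maps have kernel `Sel_𝔭^Σ(K, E[p^∞])`
(`mem_selmerAcBase_iff_locAtFinset_eq_zero_strict`), so both images are `≅ A / Sel_𝔭^Σ(K)`.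
[cite: GreenbergLNM1716, §3 Lemmas 3.1–3.3 and §4 Prop. 4.13 (the global-to-local term)] -/
theorem natCard_range_locAtFinset_eq_of_subset [IsTotallyComplex K]
    {T T' : Finset (HeightOneSpectrum (𝓞 K))} (hTT' : T ⊆ T') (h𝔭T : 𝔭 ∈ T)
    (hT'p : ∀ v ∈ T', v ≠ 𝔭 → ((p : ℕ) : 𝓞 K) ∉ v.asIdeal) (hT'S : ∀ v ∈ T', v ∉ S)
    (hS : ∀ c : E.subgroupH1 p (⊤ : Subgroup (absoluteGaloisGroup K)),
      E.resOfLe p (le_top : κ.kerSubgroup ≤ ⊤) c ∈ selmerAc E p κ 𝔭 S →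
        ∀ v : HeightOneSpectrum (𝓞 K), ((p : ℕ) : 𝓞 K) ∉ v.asIdeal → v ∉ S → v ∉ T →
          c ∈ awayKer ⊤ (E.geomPrimaryTorsion p) v) :
    Nat.card ((locAtFinset E p T').comp (selmerAcPreimage E p κ 𝔭 S).subtype).range =
      Nat.card ((locAtFinset E p T).comp (selmerAcPreimage E p κ 𝔭 S).subtype).range := by
  set A := selmerAcPreimage E p κ 𝔭 S
  set ψ := (locAtFinset E p T).comp A.subtype with hψ
  set ψ' := (locAtFinset E p T').comp A.subtype with hψ'
  have hTp : ∀ v ∈ T, v ≠ 𝔭 → ((p : ℕ) : 𝓞 K) ∉ v.asIdeal := fun v hv ↦ hT'p v (hTT' hv)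
  have hTS : ∀ v ∈ T, v ∉ S := fun v hv ↦ hT'S v (hTT' hv)
  have hS' : ∀ c : E.subgroupH1 p (⊤ : Subgroup (absoluteGaloisGroup K)),
      E.resOfLe p (le_top : κ.kerSubgroup ≤ ⊤) c ∈ selmerAc E p κ 𝔭 S →
        ∀ v : HeightOneSpectrum (𝓞 K), ((p : ℕ) : 𝓞 K) ∉ v.asIdeal → v ∉ S → v ∉ T' →
          c ∈ awayKer ⊤ (E.geomPrimaryTorsion p) v :=
    fun c hc v hpv hvS hvT' ↦ hS c hc v hpv hvS fun h ↦ hvT' (hTT' h)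
  -- both kernels are `Sel_𝔭^Σ(K, E[p^∞])`
  have hker : ∀ a : A, a ∈ ψ.ker ↔ (a : E.subgroupH1 p ⊤) ∈ selmerAcBase E p 𝔭 S := by
    intro a
    rw [AddMonoidHom.mem_ker, mem_selmerAcBase_iff_locAtFinset_eq_zero_strict h𝔭T hTp hTS hS a.2]
    rfl
  have hker' : ∀ a : A, a ∈ ψ'.ker ↔ (a : E.subgroupH1 p ⊤) ∈ selmerAcBase E p 𝔭 S := by
    intro a
    rw [AddMonoidHom.mem_ker,
      mem_selmerAcBase_iff_locAtFinset_eq_zero_strict (hTT' h𝔭T) hT'p hT'S hS' a.2]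
    rfl
  have hk : ψ'.ker = ψ.ker := by
    ext a
    rw [hker', hker]
  calc Nat.card ψ'.range
      = Nat.card (A ⧸ ψ'.ker) :=
        Nat.card_congr (QuotientAddGroup.quotientKerEquivRange ψ').toEquiv.symm
    _ = Nat.card (A ⧸ ψ.ker) := Nat.card_congr (QuotientAddGroup.quotientAddEquivOfEq hk).toEquiv
    _ = Nat.card ψ.range := Nat.card_congr (QuotientAddGroup.quotientKerEquivRange ψ).toEquiv

end Generic

/-! ## §2 At a `3`-frame: `d(T₀)` is the same for every admissible `T₀` -/

section FrameThree

variable {W : WeierstrassCurve ℚ} [W.IsElliptic] {K : Type} [Field K] [NumberField K]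
  {𝔭 : HeightOneSpectrum (𝓞 K)} {W' : WeierstrassCurve ℚ} {C : VariableChange ℚ}

/-- Away descent off `{𝔭} ∪ T₀` at a `3`-frame for anticyclotomic `κ`, from the admissibility of `T₀`
(companion V's pointwise trichotomy argument: a degree-one `v ∤ 3` outside `T₀` is good — Greenberg's
Lemma 3.3 — or has `W(K_v)[3] = 0` — `ker r_v = 0` —; an inert or ramified `v` splits completely in the
anticyclotomic tower). NO (A𝔭)₃. [cite: GreenbergLNM1716, §3 Lemma 3.3]
[cite: Castella2018, Def. 2.2 (arXiv:1704.06608 p. 5) (the away condition; shape only)] -/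
theorem awayKer_of_mem_selmerAc_of_admissible_three (hF : IsFrameThree W K 𝔭 W' C)
    (κ : ZpExtension K 3) (hκ : κ.IsAnticyclotomic)
    (T₀ : Finset (HeightOneSpectrum (𝓞 K)))
    (hv : ∀ v : HeightOneSpectrum (𝓞 K), v ∉ T₀ → ((3 : ℕ) : 𝓞 K) ∉ v.asIdeal →
      v.asIdeal.ramificationIdx (𝓞 ℚ) = 1 → v.asIdeal.inertiaDeg (𝓞 ℚ) = 1 →
      (W.baseChange K).HasGoodReductionAt v ∨
        ∀ R : ((W.baseChange K).baseChange (v.adicCompletion K)).toAffine.Point,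
          (3 : ℕ) • R = 0 → R = 0) :
    ∀ c : (W.baseChange K).subgroupH1 3 (⊤ : Subgroup (absoluteGaloisGroup K)),
      (W.baseChange K).resOfLe 3 (le_top : κ.kerSubgroup ≤ ⊤) c ∈
          selmerAc (W.baseChange K) 3 κ 𝔭 ∅ →
        ∀ v : HeightOneSpectrum (𝓞 K), ((3 : ℕ) : 𝓞 K) ∉ v.asIdeal → v ∉ (∅ : Set _) →
          v ∉ insert 𝔭 T₀ → c ∈ awayKer ⊤ ((W.baseChange K).geomPrimaryTorsion 3) v := by
  haveI hEK : (W.baseChange K).IsElliptic := by rw [baseChange]; infer_instance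
  have hK2 : Module.finrank ℚ K = 2 := hF.2.2.1.1
  intro c hc v hpv hvS hvT
  have hvT₀ : v ∉ T₀ := fun h => hvT (Finset.mem_insert_of_mem h)
  have h1 := ((mem_selmerOver_iff _).mp hc).1 v hpv hvS 1
  rw [Literature.NumberTheory.EllipticCurves.conjH1_one_holds, AddMonoidHom.id_apply] at h1
  set v₀ : HeightOneSpectrum (𝓞 ℚ) := v.under (𝓞 ℚ) with hv₀def
  rcases placesOver_trichotomy_of_finrank_eq_two K hK2 v₀ with
      ⟨w₁, w₂, -, -, hef⟩ | ⟨w, hset, -, hf⟩ | ⟨w, hset, he, -⟩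
  · obtain ⟨he, hf⟩ := hef v rfl
    rcases hv v hvT₀ hpv he hf with hgood | htors
    · exact (resOfLe_mem_awayKer_kerSubgroup_iff_of_hasGoodReductionAt (W.baseChange K) 3 κ hpv
        hgood c).mp h1
    · exact mem_awayKer_of_localKer_eq_bot hpv hvS
        (AcSelmer.localKer_eq_bot_of_noPTorsion (W.baseChange K) 3 κ v htors) hc
  · have hvw : v = w := by
      have hmem : v ∈ {w' : HeightOneSpectrum (𝓞 K) | w'.under (𝓞 ℚ) = v₀} := rfl
      rw [hset] at hmem
      exact hmem
    have hf' : v.asIdeal.inertiaDeg (𝓞 ℚ) = 2 := by rw [hvw]; exact hf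
    exact (IsAnticyclotomic.resOfLe_mem_awayKer_iff_of_inertiaDeg_eq_two hK2 hκ hpv
      (ℓ := v₀) rfl hf' c).mp h1
  · have hvw : v = w := by
      have hmem : v ∈ {w' : HeightOneSpectrum (𝓞 K) | w'.under (𝓞 ℚ) = v₀} := rfl
      rw [hset] at hmem
      exact hmem
    have he' : v.asIdeal.ramificationIdx (𝓞 ℚ) = 2 := by rw [hvw]; exact he
    exact (IsAnticyclotomic.resOfLe_mem_awayKer_iff_of_ramificationIdx_eq_two hK2 hκ hpv he'
      c).mp h1

/-- **`d(T₀') = d(T₀)` for `T₀ ⊆ T₀'`, `T₀` admissible, `T₀'` prime to `3`** — at a `3`-frame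
`(K, 𝔭, W', C)` of `W`, for every anticyclotomic `ℤ₃`-extension `κ`; NO (A𝔭)₃, no finiteness
hypothesis (`Nat.card` on both sides). §1 with `T = {𝔭} ∪ T₀ ⊆ T' = {𝔭} ∪ T₀'` and the away descent
off `{𝔭} ∪ T₀` (`awayKer_of_mem_selmerAc_of_admissible_three`). Enlarging an admissible `T₀` by further
places `v ∤ 3` does not change the displayed defect of (R-ctrl)₃ᵛ♯ / (R-EU)₃ᵛ / (R-EU)₃ᵀ / (PR|IMC)₃.
[cite: GreenbergLNM1716, §3 Lemmas 3.1–3.3 and §4 Prop. 4.13 (the global-to-local term)] -/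
theorem controlDefectAtThree_eq_of_subset (hF : IsFrameThree W K 𝔭 W' C)
    (κ : ZpExtension K 3) (hκ : κ.IsAnticyclotomic)
    {T₀ T₀' : Finset (HeightOneSpectrum (𝓞 K))} (hsub : T₀ ⊆ T₀')
    (hT₀' : ∀ v ∈ T₀', ((3 : ℕ) : 𝓞 K) ∉ v.asIdeal)
    (hv : ∀ v : HeightOneSpectrum (𝓞 K), v ∉ T₀ → ((3 : ℕ) : 𝓞 K) ∉ v.asIdeal →
      v.asIdeal.ramificationIdx (𝓞 ℚ) = 1 → v.asIdeal.inertiaDeg (𝓞 ℚ) = 1 →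
      (W.baseChange K).HasGoodReductionAt v ∨
        ∀ R : ((W.baseChange K).baseChange (v.adicCompletion K)).toAffine.Point,
          (3 : ℕ) • R = 0 → R = 0) :
    controlDefectAtThree W K 𝔭 κ T₀' = controlDefectAtThree W K 𝔭 κ T₀ := by
  haveI : IsTotallyComplex K := hF.2.2.1.2
  haveI hEK : (W.baseChange K).IsElliptic := by rw [baseChange]; infer_instance
  rw [controlDefectAtThree_def, controlDefectAtThree_def]
  exact natCard_range_locAtFinset_eq_of_subset (E := W.baseChange K)
    (S := (∅ : Set (HeightOneSpectrum (𝓞 K)))) (Finset.insert_subset_insert 𝔭 hsub)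
    (Finset.mem_insert_self 𝔭 T₀)
    (fun v hvT hne => hT₀' v ((Finset.mem_insert.mp hvT).resolve_left hne))
    (fun v _ => Set.notMem_empty v)
    (awayKer_of_mem_selmerAc_of_admissible_three hF κ hκ T₀ hv)

/-- **`d(T₀)` is the same for ANY two admissible sets `T₀`, `T₁` of places `v ∤ 3`** (at a `3`-frame,
anticyclotomic `κ`; NO (A𝔭)₃): both equal `d(T₀ ∪ T₁)` by `controlDefectAtThree_eq_of_subset`. So the
displayed defect of the typed laws at `3` is an invariant of `(W, K, 𝔭, κ)` — the laws' «for every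
admissible `T₀`» is harmless. [cite: GreenbergLNM1716, §3 Lemmas 3.1–3.3 and §4 Prop. 4.13] -/
theorem controlDefectAtThree_eq_of_admissible (hF : IsFrameThree W K 𝔭 W' C)
    (κ : ZpExtension K 3) (hκ : κ.IsAnticyclotomic)
    {T₀ T₁ : Finset (HeightOneSpectrum (𝓞 K))}
    (hT₀ : ∀ v ∈ T₀, ((3 : ℕ) : 𝓞 K) ∉ v.asIdeal) (hT₁ : ∀ v ∈ T₁, ((3 : ℕ) : 𝓞 K) ∉ v.asIdeal)
    (hv₀ : ∀ v : HeightOneSpectrum (𝓞 K), v ∉ T₀ → ((3 : ℕ) : 𝓞 K) ∉ v.asIdeal →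
      v.asIdeal.ramificationIdx (𝓞 ℚ) = 1 → v.asIdeal.inertiaDeg (𝓞 ℚ) = 1 →
      (W.baseChange K).HasGoodReductionAt v ∨
        ∀ R : ((W.baseChange K).baseChange (v.adicCompletion K)).toAffine.Point,
          (3 : ℕ) • R = 0 → R = 0)
    (hv₁ : ∀ v : HeightOneSpectrum (𝓞 K), v ∉ T₁ → ((3 : ℕ) : 𝓞 K) ∉ v.asIdeal →
      v.asIdeal.ramificationIdx (𝓞 ℚ) = 1 → v.asIdeal.inertiaDeg (𝓞 ℚ) = 1 →
      (W.baseChange K).HasGoodReductionAt v ∨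
        ∀ R : ((W.baseChange K).baseChange (v.adicCompletion K)).toAffine.Point,
          (3 : ℕ) • R = 0 → R = 0) :
    controlDefectAtThree W K 𝔭 κ T₀ = controlDefectAtThree W K 𝔭 κ T₁ := by
  have hU : ∀ v ∈ T₀ ∪ T₁, ((3 : ℕ) : 𝓞 K) ∉ v.asIdeal := fun v hv =>
    (Finset.mem_union.mp hv).elim (hT₀ v) (hT₁ v)
  rw [← controlDefectAtThree_eq_of_subset hF κ hκ Finset.subset_union_left hU hv₀,
    controlDefectAtThree_eq_of_subset hF κ hκ Finset.subset_union_right hU hv₁]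

/-- **If `∅` is admissible, every admissible `T₀` has `d(T₀) = d(∅)`** (at a `3`-frame, anticyclotomic
`κ`; NO (A𝔭)₃) — regime N, and the regime-T frames without V-type places; under (A𝔭)₃ moreover
`d(∅) = 1` (`controlDefectAtThree_empty_eq_one`). [cite: GreenbergLNM1716, §3 Lemmas 3.1–3.3] -/
theorem controlDefectAtThree_eq_empty_of_admissible (hF : IsFrameThree W K 𝔭 W' C)
    (κ : ZpExtension K 3) (hκ : κ.IsAnticyclotomic)
    (hv : ∀ v : HeightOneSpectrum (𝓞 K), ((3 : ℕ) : 𝓞 K) ∉ v.asIdeal →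
      v.asIdeal.ramificationIdx (𝓞 ℚ) = 1 → v.asIdeal.inertiaDeg (𝓞 ℚ) = 1 →
      (W.baseChange K).HasGoodReductionAt v ∨
        ∀ R : ((W.baseChange K).baseChange (v.adicCompletion K)).toAffine.Point,
          (3 : ℕ) • R = 0 → R = 0)
    (T₀ : Finset (HeightOneSpectrum (𝓞 K))) (hT₀ : ∀ v ∈ T₀, ((3 : ℕ) : 𝓞 K) ∉ v.asIdeal) :
    controlDefectAtThree W K 𝔭 κ T₀ = controlDefectAtThree W K 𝔭 κ ∅ :=
  controlDefectAtThree_eq_of_subset hF κ hκ (Finset.empty_subset T₀) hT₀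
    fun v _ hpv he hf => hv v hpv he hf

/-- **Under (A𝔭)₃ with `∅` admissible (regime N), `d(T₀) = 1` for every `T₀` prime to `3`.**
[cite: GreenbergLNM1716, §3 Lemmas 3.1–3.3] -/
theorem controlDefectAtThree_eq_one_of_admissible_empty (hF : IsFrameThree W K 𝔭 W' C)
    (κ : ZpExtension K 3) (hκ : κ.IsAnticyclotomic)
    (h𝔭 : ∀ R : ((W.baseChange K).baseChange (𝔭.adicCompletion K)).toAffine.Point,
      (3 : ℕ) • R = 0 → R = 0)
    (hv : ∀ v : HeightOneSpectrum (𝓞 K), ((3 : ℕ) : 𝓞 K) ∉ v.asIdeal →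
      v.asIdeal.ramificationIdx (𝓞 ℚ) = 1 → v.asIdeal.inertiaDeg (𝓞 ℚ) = 1 →
      (W.baseChange K).HasGoodReductionAt v ∨
        ∀ R : ((W.baseChange K).baseChange (v.adicCompletion K)).toAffine.Point,
          (3 : ℕ) • R = 0 → R = 0)
    (T₀ : Finset (HeightOneSpectrum (𝓞 K))) (hT₀ : ∀ v ∈ T₀, ((3 : ℕ) : 𝓞 K) ∉ v.asIdeal) :
    controlDefectAtThree W K 𝔭 κ T₀ = 1 := by
  rw [controlDefectAtThree_eq_empty_of_admissible hF κ hκ hv T₀ hT₀]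
  exact controlDefectAtThree_empty_eq_one κ h𝔭

end FrameThree

end Summit.BirchSwinnertonDyer.Rank1Residual.X12.O11

end
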